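import Summits.ABC.IUTFork.Conditional.AbcOfSHvolRefutation
import HarnessLib

/-!
# Crux `ThetaPartII` (stmt-ABC-19678), (U) line: the REGISTERED stub `stub_hullRegimeAbove` is FALSE — abc-iut-S4's
# negative-modulo antecedent is inhabited by the explicit admissible degree-2 family `P_k = (ℚ(√2), 1/2 + 2/(3+√2)^k)`

Record-only PROOF file (D-0012) of the abc-iut cell (R2 S-chain team, seat abc-iut-s2-p5 gen 2); TAKES NO SIDE on [IUTchIII]
Cor. 3.12, on [IUTchIV] Thm. 1.10, or on the (U)/(P) readings of "`−|log(Θ)|`". S. Mochizuki, *IUT IV* [Mochizuki2012], Thm. 1.10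
proof Steps (ii), (v)–(viii) pp. 24, 27–31; Cor. 2.2 (ii) proof (P1)–(P7) pp. 44–46. [claim: Mochizuki2012, status: disputed] for every
IUT quotation.

The active skeleton of record of the crux (RESHAPE-3, sha16 `0bf3ba3d3910cd8b`, abc-iut-c312-8) registers three stubs on two lines:
`stub_cor312` + `stub_hullRegimeAbove` ((U) line) and `stub_cor312PerImage` ((P) line). `stub_hullRegimeAbove` asks for the (U)-hull
estimate with print's `B_III(λ, l)` at every genuine Θ-volume datum that is NOT slot-constant, at every admissible `(λ, l)` (`λ ∈ U_P`,
`l ≥ 5` prime, a core, (P2), (P5), (P6)) with `2 ≤ d_mod` lying ABOVE abc-iut-c312-d1's prime-count threshold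
`40·log(d*l)·(π(d*l) − (2d_mod(log-diff + log-cond) + log(30l))/log 2) < log(q^{∤{2,l}}(λ))`. abc-iut-S4 gen 6 landed the negative-modulo
lemmas `Negative.stub_hullRegimeAbove_false_of_deepLopsidedDatum(_explicit)` (p445919 / its explicit twin): the stub is false as soon as
ONE such `(λ, l)` carries a datum and a split support prime beating the sharp slack. THIS FILE inhabits that situation — not through
S4's datum-level pair currency but through abc-iut-s2-p1 gen 2's point-level mixed-share form — and lands the UNCONDITIONAL negation:

* `Negative.exists_quadWitness_above_sharpSlack_lt` — above EVERY height, abc-iut-s2-p5's family point `P_k` with abc-iut-s2-p3's window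
  prime `l` (CondP2/P5/P6 PROVED, `h_k^{1/2} ≤ l ≤ 10δ₂·h_k^{1/2}·log(2δ₂h_k)`) satisfies `4·d_mod ≤ l + 5`, the c312-d1 THRESHOLD
  (`40·log(d*l)·π(d*l) ≤ 200·δ₂·l = O(h_k^{1/2} log h_k) < k·log 2 ≤ log q^{∤{2,l}}(λ_k)`), positive good weight over `7`, and the
  strict violation «sharp slack < mixed-height sum at `W = {7}`» (as in `Conditional.exists_quadWitness_sharpSlack_lt`, p453135);
* **`Negative.stub_hullRegimeAbove_false : ¬ (<registered `stub_hullRegimeAbove` signature VERBATIM>)`** — at that `(P_k, l)` the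
  genuine datum of `ThetaPartII.stub_thetaData` is not slot-constant (abc-iut-s2-p4's `not_slotConstant_of_unequalHeightsPoint` on
  the mixed pair `𝔭 ∋ 3+√2` (pole of `j(λ_k)`, `∤ 2l`) / `𝔭' ∋ 3−√2` (no pole) over `7`), so the stub delivers `T.HullEstimateOf B_III`;
  abc-iut-s2-p1's `PointDict.pointMixedShare_le_sub_gain_of_hullEstimateOf` turns it into «mixed sum ≤ B_III − different gain =
  sharp slack» — contradiction.

CONSEQUENCE FOR THE CRUX CHAIN (neutral): the (U) line of skeleton `0bf3ba3d3910cd8b` composes the crux from `stub_cor312` and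
`stub_hullRegimeAbove`; with the latter kernel-false the (U) line cannot close the crux as registered (its capstones
`ThetaPartII.ABC_of_cor312_of_hullRegimeAbove`, `…_of_hullRegime` stay conditional theorems with a refuted hypothesis). The (P) line
(`stub_cor312PerImage`, volume stub a THEOREM — abc-iut-c312-d1 p425589) is untouched; the crux `ThetaPartII` is NOT refuted; nothing is
asserted about [IUTchIII] Cor. 3.12, about [IUTchIV] Thm. 1.10 as printed, or about any author. What would change the typed objects
(recorded, none asserted): (R3) a reading of (Ind1) fixing the distinguished capsule index; a `B_III` with a mixed-prime allowance.
PROOF-ONLY file: no definitions, no named `Prop` facts. [cite: Mochizuki2012, IUTchIV Thm. 1.10 Steps (ii),(v)–(viii) p. 24, 27–31]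
[cite: Mochizuki2012, IUTchIV Cor. 2.2 (ii) proof (P1)–(P7) p. 44–46] [cite: DupuyHilado2025, §3.3, §3.6, §4.7, §4.12]
-/

noncomputable section

-- `Summit.<Summit>.<Problem>` is the mandated summit-side namespace (CONVENTIONS §2); for the
-- single-conjunct summit `ABC` the two coincide, so the duplicate `ABC.ABC` is deliberate.
set_option linter.dupNamespace false

namespace Summit.ABC.ABC.Theorems.ThetaPartII.Negative

open Literature.NumberTheory.DiophantineGeometry.GenEll Literature.IUT.LogVolume Literature.IUT.HodgeTheaters
open Summit.ABC.IUTFork Summit.ABC.IUTFork.PointDict Summit.ABC.IUTFork.Conditional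
open NumberField IsDedekindDomain Literature.NumberTheory.NumberFields
open scoped Classical

/-- The sharp slack IS `B_III` minus the different gain (real identity; abc-iut-s2-p1's `le_slack_of_add_gain_le`). [folklore] -/
private theorem BIII_sub_gain_eq {l d lD lC R : ℝ} (hl : 0 < l) :
    (l + 1) / 4 * ((1 + 12 * d / l) * (lD + lC) + R) - ((l + 5) / 4 - d) * (lD + (1 - 1 / l) * lC) =
      (4 * d - 1 + 3 * d / l) * (lD + lC) + (l + 5 - 4 * d) / (4 * l) * lC + (l + 1) / 4 * R := by
  field_simp
  ring

/-- A prime `l ≥ 7` different from `7` is `≥ 11`. [folklore] -/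
private theorem eleven_le_of_prime' {l : ℕ} (hl : l.Prime) (h7 : 7 ≤ l) (hne : l ≠ 7) : 11 ≤ l := by
  rcases Nat.lt_or_ge l 11 with hlt | hge
  · interval_cases l
    · exact absurd rfl hne
    · exact absurd hl (by norm_num)
    · exact absurd hl (by norm_num)
    · exact absurd hl (by norm_num)
  · exact hge

set_option maxHeartbeats 400000 in
/-- **ABOVE EVERY HEIGHT, THE FAMILY SITS ABOVE THE c312-d1 THRESHOLD AND BEATS THE SHARP SLACK.** For abc-iut-s2-p5's family
`P_k = (ℚ(√2), 1/2 + 2/(3+√2)^k)` with its places `𝔭 ∋ 3+√2`, `𝔭' ∋ 3−√2` over `7`, and every `H`: there are `k ≥ 6` and a prime `l ≥ 7`,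
`l ≠ 7`, with (P2), (P5), (P6) PROVED (abc-iut-s2-p3's window prime, `h_k^{1/2} ≤ l ≤ 10δ₂·h_k^{1/2}·log(2δ₂h_k)`), `4·d_mod ≤ l + 5`,
`H < log(q^∀(λ_k))`, the threshold of the registered `stub_hullRegimeAbove`
(`40·log(d*l)·(π(d*l) − …) ≤ 40·log(d*l)·π(d*l) ≤ 200·δ₂·l < k·log 2 ≤ log q^{∤{2,l}}(λ_k)`, abc-iut-s2-p3's `log n·π(n) ≤ 5n`), positive good
weight over `7`, and the sharp slack at `W = {7}` STRICTLY below the mixed-height sum. Same arithmetic as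
`Conditional.exists_quadWitness_sharpSlack_lt` plus one more use of `exists_sqrt_log_lt_linear`. Nothing asserted about any stub.
[cite: Mochizuki2012, IUTchIV Cor. 2.2 (ii) proof (P1)–(P7) p. 44–46] [cite: Mochizuki2012, IUTchIV Thm. 1.10 Step (v) p. 27–28]
[claim: Mochizuki2012, status: disputed] -/
theorem exists_quadWitness_above_sharpSlack_lt {𝔭 𝔭' : HeightOneSpectrum (𝓞 QuadWitness.F)}
    (ha : QuadWitness.a ∈ 𝔭.asIdeal) (habar : QuadWitness.abar ∈ 𝔭'.asIdeal) (ha' : QuadWitness.a ∉ 𝔭'.asIdeal)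
    (h7 : ((7 : ℕ) : 𝓞 QuadWitness.F) ∈ 𝔭.asIdeal) (h7' : ((7 : ℕ) : 𝓞 QuadWitness.F) ∈ 𝔭'.asIdeal) (H : ℝ) :
    ∃ k : ℕ, 6 ≤ k ∧ ∃ l : ℕ, l.Prime ∧ 7 ≤ l ∧ l ≠ 7 ∧
      Cor22.CondP2 (QuadWitness.P k) l ∧ Cor22.CondP5 (QuadWitness.P k) l ∧ Cor22.CondP6 (QuadWitness.P k) l ∧
      4 * (Cor22.dmod (QuadWitness.P k) : ℝ) ≤ (l : ℝ) + 5 ∧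
      H < Cor22.logQForall (QuadWitness.P k) ∧
      40 * Real.log (((2 ^ 12 * 3 ^ 3 * 5 * Cor22.dmod (QuadWitness.P k) : ℕ) : ℝ) * l)
        * ((Nat.primeCounting (2 ^ 12 * 3 ^ 3 * 5 * Cor22.dmod (QuadWitness.P k) * l) : ℝ)
          - (2 * (Cor22.dmod (QuadWitness.P k) : ℝ) * ((QuadWitness.P k).logDiff + Cor22.logCondAvoid (QuadWitness.P k) {2, l})
              + Real.log (2 * 3 * 5 * (l : ℝ))) / Real.log 2) < Cor22.logQAvoid (QuadWitness.P k) {2, l} ∧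
      (∀ p ∈ ({7} : Finset ℕ), 0 < ∑ V ∈ Finset.univ.filter
          (fun V : placesOver ↥(IntermediateField.adjoin ℚ ({Cor22.jInv (QuadWitness.P k).x} : Set (QuadWitness.P k).F)) p =>
            ¬ (ord _ V.1 (Cor22.jMod (QuadWitness.P k)) < 0 ∧ ((2 : ℕ) : 𝓞 _) ∉ V.1.asIdeal ∧ ((l : ℕ) : 𝓞 _) ∉ V.1.asIdeal)),
          weight _ V.1) ∧
      (4 * (Cor22.dmod (QuadWitness.P k) : ℝ) - 1 + 3 * (Cor22.dmod (QuadWitness.P k) : ℝ) / l) *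
            ((QuadWitness.P k).logDiff + Cor22.logCondAvoid (QuadWitness.P k) {2, l})
          + ((l : ℝ) + 5 - 4 * (Cor22.dmod (QuadWitness.P k) : ℝ)) / (4 * (l : ℝ)) * Cor22.logCondAvoid (QuadWitness.P k) {2, l}
          + ((l : ℝ) + 1) / 4 * (2 * Real.log l + 52
            + 20 / 3 * Real.log (((2 ^ 12 * 3 ^ 3 * 5 * Cor22.dmod (QuadWitness.P k) : ℕ) : ℝ) * (l : ℝ))
              * (Nat.primeCounting (2 ^ 12 * 3 ^ 3 * 5 * Cor22.dmod (QuadWitness.P k) * l) : ℝ)) <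
        ∑ p ∈ ({7} : Finset ℕ), (1 / (2 * (l : ℝ)) *
          ∑ V : placesOver ↥(IntermediateField.adjoin ℚ ({Cor22.jInv (QuadWitness.P k).x} : Set (QuadWitness.P k).F)) p,
            (if ord _ V.1 (Cor22.jMod (QuadWitness.P k)) < 0 ∧ ((2 : ℕ) : 𝓞 _) ∉ V.1.asIdeal ∧ ((l : ℕ) : 𝓞 _) ∉ V.1.asIdeal then
              weight _ V.1 * (((-ord _ V.1 (Cor22.jMod (QuadWitness.P k)) : ℤ) : ℝ) * logNorm _ V.1 / (localDegree _ V.1 : ℝ))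
             else 0)) *
          ((l : ℝ) * ((l : ℝ) + 1) / 12
            - 4 * (1 - ∑ V ∈ Finset.univ.filter
                  (fun V : placesOver ↥(IntermediateField.adjoin ℚ ({Cor22.jInv (QuadWitness.P k).x} : Set (QuadWitness.P k).F)) p =>
                    ¬ (ord _ V.1 (Cor22.jMod (QuadWitness.P k)) < 0 ∧ ((2 : ℕ) : 𝓞 _) ∉ V.1.asIdeal ∧
                      ((l : ℕ) : 𝓞 _) ∉ V.1.asIdeal)),
                  weight _ V.1) /
              (((l : ℝ) - 1) * (∑ V ∈ Finset.univ.filter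
                  (fun V : placesOver ↥(IntermediateField.adjoin ℚ ({Cor22.jInv (QuadWitness.P k).x} : Set (QuadWitness.P k).F)) p =>
                    ¬ (ord _ V.1 (Cor22.jMod (QuadWitness.P k)) < 0 ∧ ((2 : ℕ) : 𝓞 _) ∉ V.1.asIdeal ∧
                      ((l : ℕ) : 𝓞 _) ∉ V.1.asIdeal)),
                  weight _ V.1) ^ 3)) := by
  haveI h7p : Fact (Nat.Prime 7) := ⟨by norm_num⟩
  obtain ⟨H₀, hH₀⟩ := Cor22Window.exists_admissible_prime_window (CBData.std {2} QuadWitness.hS2) 2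
  obtain ⟨A, B, hA0, hB0, hAB⟩ := logQForall_quadWitness_le
  have hlog2 : 0 < Real.log 2 := Real.log_pos (by norm_num)
  -- the two places over `7` as elements of `V(F)_7`
  let v₀ : placesOver QuadWitness.F 7 := ⟨𝔭, Cor22.mem_placesOver_of_natCast_mem 7 𝔭 h7⟩
  let w : placesOver QuadWitness.F 7 := ⟨𝔭', Cor22.mem_placesOver_of_natCast_mem 7 𝔭' h7'⟩
  have hvw : w ≠ v₀ := by
    intro h
    have : 𝔭' = 𝔭 := congrArg Subtype.val h
    exact ha' (this ▸ ha)
  obtain ⟨hn1, -⟩ := SplitDepth.localDegree_eq_one QuadWitness.finrank_F v₀ w hvw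
  obtain ⟨hwt1, hlog7⟩ := SplitDepth.weight_eq_half_and_logNorm_eq QuadWitness.finrank_F v₀ w hvw
  obtain ⟨hwt2, -⟩ := SplitDepth.weight_eq_half_and_logNorm_eq QuadWitness.finrank_F w v₀ (Ne.symm hvw)
  have h2𝔭 : ((2 : ℕ) : 𝓞 QuadWitness.F) ∉ v₀.1.asIdeal :=
    SplitDepth.natCast_not_mem_of_prime_ne v₀ Nat.prime_two (by norm_num)
  have hlD : ∀ k, (QuadWitness.P k).logDiff = (QuadWitness.P 0).logDiff := fun _ => rfl
  have hδ : (0 : ℝ) < Cor22.delta 2 := by norm_num [Cor22.delta]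
  have hlogQ : ∀ {k : ℕ}, 1 ≤ k → (k : ℝ) * Real.log 2 ≤ Cor22.logQForall (QuadWitness.P k) := fun {k} hk1 =>
    (QuadWitness.le_logQAvoid_P ha h7 hk1 Nat.prime_three (by norm_num)).trans
      (Cor22.logQAvoid_anti (QuadWitness.P k) (Finset.empty_subset _))
  -- case `B = 0`: the height would be bounded — absurd
  rcases hB0.eq_or_lt with hB | hB
  · exfalso
    have h1 := hlogQ (k := ⌈A / Real.log 2⌉₊ + 1) (by omega)
    have h2 := hAB (⌈A / Real.log 2⌉₊ + 1)
    rw [← hB, zero_mul, add_zero] at h2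
    have h3 : A / Real.log 2 ≤ ⌈A / Real.log 2⌉₊ := Nat.le_ceil _
    rw [div_le_iff₀ hlog2] at h3
    have h4 : (((⌈A / Real.log 2⌉₊ + 1 : ℕ) : ℝ)) * Real.log 2 = (⌈A / Real.log 2⌉₊ : ℝ) * Real.log 2 + Real.log 2 := by
      push_cast; ring
    linarith
  -- case `B > 0`: the growth lemma, twice (sharp slack; threshold)
  obtain ⟨H₁, -, hH₁⟩ := exists_sqrt_log_lt_linear (8 * (QuadWitness.P 0).logDiff + 13 + A * (Real.log 7 / (48 * B)))
    (33 / 4) (85 * Cor22.delta 2 ^ 2) (2 * Cor22.delta 2) (Real.log 7 / (48 * B)) (by positivity) (by positivity)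
    (by have := Real.log_pos (by norm_num : (1 : ℝ) < 7); positivity)
  obtain ⟨H₂, -, hH₂⟩ := exists_sqrt_log_lt_linear (A * (Real.log 2 / B)) 0 (2000 * Cor22.delta 2 ^ 2)
    (2 * Cor22.delta 2) (Real.log 2 / B) (by positivity) (by positivity) (by positivity)
  -- choose `k`
  set X : ℝ := max (max H H₀) (max H₁ H₂) with hX
  refine ⟨max 71 (⌈X / Real.log 2⌉₊ + 1), le_trans (by norm_num) (le_max_left _ _), ?_⟩
  set k : ℕ := max 71 (⌈X / Real.log 2⌉₊ + 1) with hk_def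
  have hk71 : 71 ≤ k := le_max_left _ _
  have hk6 : 6 ≤ k := le_trans (by norm_num) hk71
  have hk1 : 1 ≤ k := le_trans (by norm_num) hk71
  have hkX : X < (k : ℝ) * Real.log 2 := by
    have h1 : X / Real.log 2 ≤ ⌈X / Real.log 2⌉₊ := Nat.le_ceil _
    rw [div_le_iff₀ hlog2] at h1
    have h2 : ((⌈X / Real.log 2⌉₊ + 1 : ℕ) : ℝ) ≤ (k : ℝ) := by exact_mod_cast le_max_right _ _
    have h3 := mul_le_mul_of_nonneg_right h2 hlog2.le
    have h4 : (((⌈X / Real.log 2⌉₊ + 1 : ℕ) : ℝ)) * Real.log 2 = (⌈X / Real.log 2⌉₊ : ℝ) * Real.log 2 + Real.log 2 := by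
      push_cast; ring
    linarith
  have hQ := hlogQ hk1
  have hH : H < Cor22.logQForall (QuadWitness.P k) :=
    lt_of_le_of_lt ((le_max_left _ _).trans (le_max_left _ _)) (hkX.trans_le hQ)
  have hH0' : H₀ < Cor22.logQForall (QuadWitness.P k) :=
    lt_of_le_of_lt ((le_max_right _ _).trans (le_max_left _ _)) (hkX.trans_le hQ)
  have hH1' : H₁ ≤ Cor22.logQForall (QuadWitness.P k) :=
    (((le_max_left _ _).trans (le_max_right _ _)).trans hkX.le).trans hQ
  have hH2' : H₂ ≤ Cor22.logQForall (QuadWitness.P k) :=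
    (((le_max_right _ _).trans (le_max_right _ _)).trans hkX.le).trans hQ
  have h49 : (49 : ℝ) < Cor22.logQForall (QuadWitness.P k) := by
    have h71 : (71 : ℝ) ≤ k := by exact_mod_cast hk71
    have h1 := mul_le_mul_of_nonneg_right h71 hlog2.le
    have h2 := Real.log_two_gt_d9
    linarith
  have hhpos : 0 < Cor22.logQForall (QuadWitness.P k) := by linarith
  have hp : ((7 : ℕ) : ℝ) < Real.sqrt (Cor22.logQForall (QuadWitness.P k)) := by
    rw [show ((7 : ℕ) : ℝ) = Real.sqrt (7 ^ 2) by rw [Real.sqrt_sq (by norm_num)]; norm_num]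
    exact Real.sqrt_lt_sqrt (by norm_num) (by norm_num; exact h49)
  obtain ⟨htop, hd⟩ := quadWitness_adjoin_jInv_eq_top ha habar ha' h7 h7' hk1
  have hjv : ord QuadWitness.F v₀.1 (Cor22.jInv (QuadWitness.lam k)) ≤ -(2 * k : ℤ) :=
    QuadWitness.ord_jInv_lam_le ha h7 hk1
  have hjw : 0 ≤ ord QuadWitness.F w.1 (Cor22.jInv (QuadWitness.lam k)) :=
    (QuadWitness.ord_at_good h7' habar ha' k).2.ge
  have hneg : ord QuadWitness.F v₀.1 (Cor22.jInv (QuadWitness.lam k)) < 0 := by omega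
  have hdeg : (QuadWitness.P k).degree ≤ 2 := by
    change Module.finrank ℚ QuadWitness.F ≤ 2
    rw [QuadWitness.finrank_F]
  -- the window prime
  obtain ⟨l, hlp, hl7, hlp', hP2, hP5, hP6, hlo, hhi⟩ :=
    hH₀ (QuadWitness.P k) (QuadWitness.P_mem_UP ha habar ha' h7 h7' hk6) (QuadWitness.P_mem_std hk6) hdeg v₀
      (by norm_num) hneg hH0' hp
  have hl11 : 11 ≤ l := eleven_le_of_prime' hlp hl7 hlp'
  have hl11' : (11 : ℝ) ≤ l := by exact_mod_cast hl11
  have hl𝔭 : ((l : ℕ) : 𝓞 QuadWitness.F) ∉ v₀.1.asIdeal := SplitDepth.natCast_not_mem_of_prime_ne v₀ hlp hlp'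
  have hdR : (Cor22.dmod (QuadWitness.P k) : ℝ) = 2 := by exact_mod_cast hd
  -- the two place sums at `7`
  have hS := mul_log_le_badHeightSum (P := QuadWitness.P k) (l := l) htop v₀.2 hjv hk1 h2𝔭 hl𝔭 hwt1 hn1 hlog7
  have hωA := half_le_goodWeightSum (P := QuadWitness.P k) htop w.2 hjw hwt2 l
  have h7c : ((7 : ℕ) : ℝ) = 7 := by norm_num
  rw [h7c] at hS
  -- the `q`-parameter height away from `{2, l}` is at least `k·log 2`
  have hQl : (k : ℝ) * Real.log 2 ≤ Cor22.logQAvoid (QuadWitness.P k) {2, l} := QuadWitness.le_logQAvoid_P ha h7 hk1 hlp hlp'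
  refine ⟨l, hlp, hl7, hlp', hP2, hP5, hP6, ?_, hH, ?_, ?_, ?_⟩
  · rw [hdR]; linarith
  · -- the c312-d1 threshold: `40·log(d*l)·(π(d*l) − X) ≤ 40·log(d*l)·π(d*l) ≤ 200·δ₂·l < k·log 2 ≤ log q^{∤{2,l}}`
    rw [hlD k, hd]
    have e1 : (2 ^ 12 * 3 ^ 3 * 5 * 2 : ℕ) = 2 ^ 13 * 3 ^ 3 * 5 := by norm_num
    rw [e1]
    have hn2 : 2 ≤ 2 ^ 13 * 3 ^ 3 * 5 * l := by
      calc 2 ≤ 2 ^ 13 * 3 ^ 3 * 5 * 1 := by norm_num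
        _ ≤ 2 ^ 13 * 3 ^ 3 * 5 * l := Nat.mul_le_mul_left _ (by omega)
    have hpi := Cor22Window.log_mul_primeCounting_le hn2
    have hcast : ((2 ^ 13 * 3 ^ 3 * 5 * l : ℕ) : ℝ) = ((2 ^ 13 * 3 ^ 3 * 5 : ℕ) : ℝ) * (l : ℝ) := by push_cast; ring
    rw [hcast] at hpi
    have hc : ((2 ^ 13 * 3 ^ 3 * 5 : ℕ) : ℝ) = Cor22.delta 2 := by simp [Cor22.delta]; norm_num
    rw [hc] at hpi ⊢
    set LOG : ℝ := Real.log (Cor22.delta 2 * (l : ℝ)) with hLOG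
    set PI : ℝ := ((Nat.primeCounting (2 ^ 13 * 3 ^ 3 * 5 * l) : ℕ) : ℝ) with hPI
    set Xt : ℝ := (2 * ((2 : ℕ) : ℝ) * ((QuadWitness.P 0).logDiff + Cor22.logCondAvoid (QuadWitness.P k) {2, l})
        + Real.log (2 * 3 * 5 * (l : ℝ))) / Real.log 2 with hXt
    have hl1R : (1 : ℝ) ≤ (l : ℝ) := by linarith
    have hLOG0 : 0 ≤ LOG := Real.log_nonneg (by nlinarith [show (1 : ℝ) ≤ Cor22.delta 2 by norm_num [Cor22.delta]])
    have hXt0 : 0 ≤ Xt := by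
      have h30 : 0 ≤ Real.log (2 * 3 * 5 * (l : ℝ)) := Real.log_nonneg (by linarith)
      have hD : 0 ≤ (QuadWitness.P 0).logDiff + Cor22.logCondAvoid (QuadWitness.P k) {2, l} :=
        add_nonneg (NFPoint.logDiff_nonneg _) (Cor22.logCondAvoid_nonneg _ _)
      rw [hXt]
      positivity
    have h1 : 40 * LOG * (PI - Xt) ≤ 40 * LOG * PI := mul_le_mul_of_nonneg_left (sub_le_self PI hXt0) (by positivity)
    have e2 : 40 * LOG * PI = 40 * (LOG * PI) := by ring
    have h3 : 200 * (Cor22.delta 2 * (l : ℝ)) ≤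
        200 * (Cor22.delta 2 * (10 * Cor22.delta 2 * Real.sqrt (Cor22.logQForall (QuadWitness.P k)) *
          Real.log (2 * Cor22.delta 2 * Cor22.logQForall (QuadWitness.P k)))) :=
      mul_le_mul_of_nonneg_left (mul_le_mul_of_nonneg_left hhi hδ.le) (by norm_num)
    have e3 : 200 * (Cor22.delta 2 * (10 * Cor22.delta 2 * Real.sqrt (Cor22.logQForall (QuadWitness.P k)) *
          Real.log (2 * Cor22.delta 2 * Cor22.logQForall (QuadWitness.P k)))) =
        2000 * Cor22.delta 2 ^ 2 * Real.sqrt (Cor22.logQForall (QuadWitness.P k)) *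
          Real.log (2 * Cor22.delta 2 * Cor22.logQForall (QuadWitness.P k)) := by ring
    have h4 := hH₂ _ hH2'
    have h5 : Real.log 2 / B * Cor22.logQForall (QuadWitness.P k) ≤ Real.log 2 / B * (A + B * k) :=
      mul_le_mul_of_nonneg_left (hAB k) (by positivity)
    have e5 : Real.log 2 / B * (A + B * k) = A * (Real.log 2 / B) + k * Real.log 2 := by
      field_simp
    have hzero : (0 : ℝ) * Real.sqrt (Cor22.logQForall (QuadWitness.P k)) = 0 := zero_mul _
    linarith
  · intro p hp7
    rw [Finset.mem_singleton] at hp7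
    subst hp7
    exact lt_of_lt_of_le one_half_pos hωA
  · rw [Finset.sum_singleton]
    have hE : 2 * Real.log l + 52
        + 20 / 3 * Real.log (((2 ^ 12 * 3 ^ 3 * 5 * Cor22.dmod (QuadWitness.P k) : ℕ) : ℝ) * (l : ℝ))
          * (Nat.primeCounting (2 ^ 12 * 3 ^ 3 * 5 * Cor22.dmod (QuadWitness.P k) * l) : ℝ) ≤
        34 * Cor22.delta 2 * l + 52 := by
      rw [hd]
      have e1 : (2 ^ 12 * 3 ^ 3 * 5 * 2 : ℕ) = 2 ^ 13 * 3 ^ 3 * 5 := by norm_num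
      rw [e1]
      have hc : ((2 ^ 13 * 3 ^ 3 * 5 : ℕ) : ℝ) = Cor22.delta 2 := by simp [Cor22.delta]; norm_num
      rw [← hc]
      exact Cor22Window.errTerm_le (l := l) (by omega)
    have hlC := logCondAvoid_le_logQForall (QuadWitness.P k) {2, l}
    rw [hlD k]
    exact sharp_violation_real hdR hl11' hδ (NFPoint.logDiff_nonneg _) (Cor22.logCondAvoid_nonneg _ _) hlC hhpos hlo hhi
      (hAB k) hB hS (Nat.cast_nonneg k) hωA hE (hH₁ _ hH1')

/-- **THE REGISTERED (U)-LINE STUB `stub_hullRegimeAbove` OF CRUX `ThetaPartII` IS FALSE.** The signature of record (skeleton sha16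
`0bf3ba3d3910cd8b`, abc-iut-c312-8; = the `habove` binder of `ThetaPartII.ABC_of_cor312_of_hullRegimeAbove`) VERBATIM, negated
UNCONDITIONALLY: at the `(P_k, l)` of `exists_quadWitness_above_sharpSlack_lt` (admissible, `2 ≤ d_mod`, above the threshold) the
genuine datum `T` of `ThetaPartII.stub_thetaData` is not slot-constant (abc-iut-s2-p4's `not_slotConstant_of_unequalHeightsPoint` on the mixed
pair over `7`), so the stub yields `T.HullEstimateOf B_III(λ_k, l)`, whence (abc-iut-s2-p1's `PointDict.pointMixedShare_le_sub_gain_of_hullEstimateOf`)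
the mixed-height sum at `W = {7}` is `≤ B_III − different gain = sharp slack` — contradicting the strict violation. This inhabits abc-iut-S4's
negative-modulo antecedent (`stub_hullRegimeAbove_false_of_deepLopsidedDatum`, p445919) with an explicit family; the (U) line of the
skeleton cannot close the crux as registered. The crux `ThetaPartII`, the (P) line, [IUTchIII] Cor. 3.12 and [IUTchIV] Thm. 1.10 AS PRINTED
are NOT addressed; no side taken; typed ≠ proved. [cite: Mochizuki2012, IUTchIV Thm. 1.10 Steps (v)–(viii) p. 27–31]
[cite: Mochizuki2012, IUTchIV Cor. 2.2 (ii) proof p. 44–46] [claim: Mochizuki2012, status: disputed] -/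
theorem stub_hullRegimeAbove_false :
    ¬ (∀ P : NFPoint, P ∈ UP → ∀ l : ℕ, l.Prime → 5 ≤ l →
      Cor22.AdmitsCore P → Cor22.CondP2 P l → Cor22.CondP5 P l → Cor22.CondP6 P l →
      2 ≤ Cor22.dmod P →
      40 * Real.log (((2 ^ 12 * 3 ^ 3 * 5 * Cor22.dmod P : ℕ) : ℝ) * l)
        * ((Nat.primeCounting (2 ^ 12 * 3 ^ 3 * 5 * Cor22.dmod P * l) : ℝ)
          - (2 * (Cor22.dmod P : ℝ) * (P.logDiff + Cor22.logCondAvoid P {2, l}) + Real.log (2 * 3 * 5 * (l : ℝ)))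
            / Real.log 2) < Cor22.logQAvoid P {2, l} →
      ∀ T : Cor22.ThetaVolumeDatumAt P l,
        (letI := T.instFieldF; letI := T.instNumberFieldF; letI := T.instAlgebraF; letI := T.instFieldK
         letI := T.instNumberFieldK; letI := T.instAlgebraK; letI := T.instFieldFbar; letI := T.instAlgebraFbar
         letI := T.instAlgebraKFbar; letI := T.instIsElliptic
         ¬ (∀ p ∈ T.I.supportPrimes, ∀ v w : placesOver (fieldOfModuli T.E) p,
            (Summit.ABC.IUTFork.DHData.ofInput T.I).logQloc p v = (Summit.ABC.IUTFork.DHData.ofInput T.I).logQloc p w)) →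
        T.HullEstimateOf
          (((l : ℝ) + 1) / 4 *
            ((1 + 12 * (Cor22.dmod P : ℝ) / l) * (P.logDiff + Cor22.logCondAvoid P {2, l})
              + 2 * Real.log l + 52
              + 20 / 3 * Real.log (((2 ^ 12 * 3 ^ 3 * 5 * Cor22.dmod P : ℕ) : ℝ) * (l : ℝ))
                * (Nat.primeCounting (2 ^ 12 * 3 ^ 3 * 5 * Cor22.dmod P * l) : ℝ)))) := by
  intro habove
  haveI h7p : Fact (Nat.Prime 7) := ⟨by norm_num⟩
  obtain ⟨𝔭, 𝔭', ha, habar, ha', -, h7, h7'⟩ := QuadWitness.exists_places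
  obtain ⟨k, hk6, l, hlp, hl7, hlp', hP2, hP5, hP6, h4d, -, hthr, hω, hlt⟩ :=
    exists_quadWitness_above_sharpSlack_lt ha habar ha' h7 h7' 0
  have hk1 : 1 ≤ k := by omega
  have h5 : 5 ≤ l := by omega
  have hP : QuadWitness.P k ∈ UP := QuadWitness.P_mem_UP ha habar ha' h7 h7' hk6
  have hcore : Cor22.AdmitsCore (QuadWitness.P k) := QuadWitness.admitsCore_P ha h7 hk1
  have hd2 : 2 ≤ Cor22.dmod (QuadWitness.P k) := QuadWitness.two_le_dmod_P ha habar ha' h7 h7' hk1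
  have h𝔭 : 𝔭 ∈ placesOver QuadWitness.F 7 := Cor22.mem_placesOver_of_natCast_mem 7 𝔭 h7
  have h𝔭' : 𝔭' ∈ placesOver QuadWitness.F 7 := Cor22.mem_placesOver_of_natCast_mem 7 𝔭' h7'
  -- the mixed pair over `7`: `𝔭` is a (P5)-bad place at `(P_k, l)`, `𝔭'` is not even a pole
  have hjv : ord QuadWitness.F 𝔭 (Cor22.jInv (QuadWitness.lam k)) ≤ -(2 * k : ℤ) := QuadWitness.ord_jInv_lam_le ha h7 hk1
  have hVb : 𝔭 ∈ Cor22.badPlacesAvoid (QuadWitness.P k) {2, l} := by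
    rw [Cor22.badPlacesAvoid, Finset.mem_filter, Cor22.mem_badPlaces_iff_ord_neg]
    refine ⟨by change ord QuadWitness.F 𝔭 (Cor22.jInv (QuadWitness.lam k)) < 0; omega, fun p hp => ?_⟩
    simp only [Finset.mem_insert, Finset.mem_singleton] at hp
    rcases hp with rfl | rfl
    · exact SplitDepth.natCast_not_mem_of_prime_ne ⟨𝔭, h𝔭⟩ Nat.prime_two (by norm_num)
    · exact SplitDepth.natCast_not_mem_of_prime_ne ⟨𝔭, h𝔭⟩ hlp hlp'
  have hWnot : 𝔭' ∉ Cor22.badPlacesAvoid (QuadWitness.P k) {2, l} := by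
    intro hmem
    have hb := (Cor22.mem_badPlaces_iff_ord_neg (QuadWitness.P k) 𝔭').mp (Cor22.badPlacesAvoid_subset _ _ hmem)
    have h0 : ord QuadWitness.F 𝔭' (Cor22.jInv (QuadWitness.lam k)) = 0 := (QuadWitness.ord_at_good h7' habar ha' k).2
    change ord QuadWitness.F 𝔭' (Cor22.jInv (QuadWitness.lam k)) < 0 at hb
    omega
  -- the stub at the genuine datum: the datum is not slot-constant, so it delivers the hull estimate with `B_III`
  obtain ⟨T⟩ := Summit.ABC.ABC.Theorems.ThetaPartII.stub_thetaData (QuadWitness.P k) hP l hlp h5 hcore hP2 hP5 hP6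
  have hns := not_slotConstant_of_unequalHeightsPoint T h𝔭 h𝔭' hVb (fun hW => absurd hW hWnot)
  have hT := habove (QuadWitness.P k) hP l hlp h5 hcore hP2 hP5 hP6 hd2 hthr T hns
  -- the mixed sum at `W = {7}` is then at most `B_III − different gain`, which IS the sharp slack
  have hmix := pointMixedShare_le_sub_gain_of_hullEstimateOf T hT hlp.pos h4d {7}
    (fun p hp => by rw [Finset.mem_singleton] at hp; subst hp; norm_num) hω
  have hl0 : (0 : ℝ) < (l : ℝ) := by exact_mod_cast hlp.pos
  have key := BIII_sub_gain_eq (d := (Cor22.dmod (QuadWitness.P k) : ℝ)) (lD := (QuadWitness.P k).logDiff)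
    (lC := Cor22.logCondAvoid (QuadWitness.P k) {2, l})
    (R := 2 * Real.log l + 52
      + 20 / 3 * Real.log (((2 ^ 12 * 3 ^ 3 * 5 * Cor22.dmod (QuadWitness.P k) : ℕ) : ℝ) * (l : ℝ))
        * (Nat.primeCounting (2 ^ 12 * 3 ^ 3 * 5 * Cor22.dmod (QuadWitness.P k) * l) : ℝ)) hl0
  have e : ((l : ℝ) + 1) / 4 *
        ((1 + 12 * (Cor22.dmod (QuadWitness.P k) : ℝ) / l) * ((QuadWitness.P k).logDiff + Cor22.logCondAvoid (QuadWitness.P k) {2, l})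
          + 2 * Real.log l + 52
          + 20 / 3 * Real.log (((2 ^ 12 * 3 ^ 3 * 5 * Cor22.dmod (QuadWitness.P k) : ℕ) : ℝ) * (l : ℝ))
            * (Nat.primeCounting (2 ^ 12 * 3 ^ 3 * 5 * Cor22.dmod (QuadWitness.P k) * l) : ℝ)) =
      ((l : ℝ) + 1) / 4 *
        ((1 + 12 * (Cor22.dmod (QuadWitness.P k) : ℝ) / l) * ((QuadWitness.P k).logDiff + Cor22.logCondAvoid (QuadWitness.P k) {2, l})
          + (2 * Real.log l + 52
            + 20 / 3 * Real.log (((2 ^ 12 * 3 ^ 3 * 5 * Cor22.dmod (QuadWitness.P k) : ℕ) : ℝ) * (l : ℝ))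
              * (Nat.primeCounting (2 ^ 12 * 3 ^ 3 * 5 * Cor22.dmod (QuadWitness.P k) * l) : ℝ))) := by ring
  rw [e] at hmix
  linarith

end Summit.ABC.ABC.Theorems.ThetaPartII.Negative

end
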